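import Mathlib
import Summits.Langlands.Langlands.Theorems.ParityBlindBianchiIcosahedralQuadraticDescentFrobRoots

/-!
# Icosahedral descent (crux `IcosahedralDescentLevel`, line `Sketch`) — transfer to the `ι`-free datum

The route's crux packages the automorphic input over an imaginary quadratic field `K` through a
`2`-adic model `σ = ι⁻¹ ∘ ρ|_K` (entrywise) and the summit's compatibility predicate
`Summit.Langlands.SatakeFrobCompatibleAt ι π σ w` (arithmetic normalisation: the arithmetic
Frobenii have characteristic polynomial `∏ (X - ι⁻¹(α_j⁻¹))`).  Pointwise at every good place this is
transported to Tunnell's `FrobSatakeCompatibleAt (ρ|_K) P w` for the contragredient cuspidal datum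
`P = π^∨` (Satake parameters inverted at EVERY place: the proved fact
`CuspidalAutomorphicRepData.exists_contragredient_satake_holds`), using the pointwise dictionary of
`…IcosahedralQuadraticDescentFrobRoots` (`isUnramifiedAt_of_entrywise`, `hasFrobCharpolyAt_of_entrywise`).
This is the every-good-place form of `exists_isPiOfArtinRep_of_satakeFrobCompatibleAt` (there a.e.).
-/

-- `Summit.Langlands.Langlands.…`: the repeated path component is the tree's layout (D-0017).
set_option linter.dupNamespace false

noncomputable section

open scoped MatrixGroups NumberField Polynomial Classical
open NumberField IsDedekindDomain Field Filter
open Literature.NumberTheory.Automorphic Literature.NumberTheory.GaloisRepresentations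
open Summit.Langlands.Langlands.Theorems.IcosahedralQuadraticDescent

namespace Summit.Langlands.Langlands.Theorems.IcosahedralDescentLevel

/-- **From the route's `2`-adic packaging to the `ι`-free datum, at every good place.**  If `σ` is
entrywise the `ι`-transport of `ρ|_K` and the cuspidal `π` is Satake–Frobenius compatible with `σ`
(summit normalisation, inverse roots) at every place `w` over no element of `S₀`, then the
contragredient cuspidal datum `P = π^∨` (`exists_contragredient_satake_holds`) is Frobenius–Satake
compatible with `ρ|_K` (Tunnell's sense) at every such `w`. [folklore] -/
theorem exists_frobSatakeCompatible_of_model (ι : PadicAlgCl 2 ≃+* ℂ) (ρ : FramedArtinRep ℚ 2) (S₀ : Finset ℕ)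
    (K : Type) [Field K] [NumberField K] (σ : FramedGaloisRep K (PadicAlgCl 2) 2)
    (hcpt : isCompact_glFiniteIntegralLevel 2 K) (π : CuspidalAutomorphicRepData 2 K hcpt)
    (hσ : ∀ (g : absoluteGaloisGroup K) (i j : Fin 2), ι ((σ g).val i j) = ((ρ.restrictField K) g).val i j)
    (hπ : ∀ w : HeightOneSpectrum (𝓞 K), (∀ ℓ ∈ S₀, ((ℓ : ℕ) : 𝓞 K) ∉ w.asIdeal) →
      Summit.Langlands.SatakeFrobCompatibleAt ι π.1 σ w) :
    ∃ P : CuspidalAutomorphicRepData 2 K hcpt,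
      ∀ w : HeightOneSpectrum (𝓞 K), (∀ ℓ ∈ S₀, ((ℓ : ℕ) : 𝓞 K) ∉ w.asIdeal) →
        FrobSatakeCompatibleAt (ρ.restrictField K) P.1 w := by
  obtain ⟨P, hP⟩ := CuspidalAutomorphicRepData.exists_contragredient_satake_holds (hcpt := hcpt) π
  refine ⟨P, fun w hw => ?_⟩
  obtain ⟨α, hα, hunr, hpoly⟩ := hπ w hw
  exact ⟨α.map (·⁻¹), hP w α hα, isUnramifiedAt_of_entrywise ι σ (ρ.restrictField K) hσ hunr,
    hasFrobCharpolyAt_of_entrywise ι σ (ρ.restrictField K) hσ hpoly⟩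

end Summit.Langlands.Langlands.Theorems.IcosahedralDescentLevel

end
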